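import Literature.Topology.FourManifolds.HomotopySpheres
import Literature.Geometry.Symplectic.SphereProdSymplecticHost

/-!
# Line `stable-seam-host` (crux `OrigamiFoldExistence`, stmt-SmoothPoincare4-7844): stub `stub_reembedAlongDiffeo`

Registry v2 (lead c10).  The formal TRANSPORT step of the line: post-composing a
fake-ball-neighbourhood embedding `J : S → X` (a map that is `C^∞`, injective and has bijective
differential on an open set `U ⊇ S ∖ e(B̊⁴)`) with a `C^∞` diffeomorphism `φ : X ≅ Y` of
`ℝ⁴`-charted hosts gives a fake-ball-neighbourhood embedding `φ ∘ J : S → Y`, on the SAME open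
set `U`: smoothness by `ContMDiff.comp_contMDiffOn`, injectivity by `EquivLike.injective φ`, and
bijectivity of the differential by the chain rule `mfderiv_comp` and bijectivity of `dφ`
(`Literature.Geometry.Symplectic.bijective_mfderiv_diffeomorph`, Mathlib's
`Diffeomorph.mfderivToContinuousLinearEquiv`).

No definitions, no named facts, no `sorry`.
-/

noncomputable section

-- the prescribed namespace `Summit.<P>.<Sub>.…` duplicates `SmoothPoincare4` (P = Sub)
set_option linter.dupNamespace false

open scoped Manifold ContDiff Topology
open Set Function

namespace Summit.SmoothPoincare4.SmoothPoincare4.Theorems.OrigamiFoldExistence.StableSeamHost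

open Literature.Geometry.Symplectic Literature.Topology.FourManifolds

/-- **Fake-ball-neighbourhood embeddings are transported by diffeomorphisms of the host**
(registered STUB `stub_reembedAlongDiffeo` of line `stable-seam-host`, signature verbatim): if
`J : S → X` is `C^∞`, injective and has bijective differential on an open `U ⊇ S ∖ e(B̊⁴)`, and
`φ : X ≅ Y` is a `C^∞` diffeomorphism, then so is `φ ∘ J` on the same `U` (chain rule
`d(φ ∘ J)_x = dφ_{J x} ∘ dJ_x`, and `dφ` is bijective; Lee 2013, Prop. 3.6). [folklore] -/
theorem stub_reembedAlongDiffeo : ∀ (S : Literature.Topology.FourManifolds.HomotopySphere 4) (e : EuclideanSpace ℝ (Fin 4) → S.carrier) (X : Type) [TopologicalSpace X] [ChartedSpace (EuclideanSpace ℝ (Fin 4)) X] [IsManifold (𝓡 4) ∞ X] (Y : Type) [TopologicalSpace Y] [ChartedSpace (EuclideanSpace ℝ (Fin 4)) Y] [IsManifold (𝓡 4) ∞ Y] (J : S.carrier → X) (φ : X ≃ₘ⟮𝓡 4, 𝓡 4⟯ Y), (∃ U : Set S.carrier, IsOpen U ∧ (e '' Metric.ball (0 : EuclideanSpace ℝ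 (Fin 4)) 1)ᶜ ⊆ U ∧ ContMDiffOn (𝓡 4) (𝓡 4) ∞ J U ∧ Set.InjOn J U ∧ ∀ x ∈ U, Function.Bijective (mfderiv (𝓡 4) (𝓡 4) J x)) → (∃ U : Set S.carrier, IsOpen U ∧ (e '' Metric.ball (0 : EuclideanSpace ℝ (Fin 4)) 1)ᶜ ⊆ U ∧ ContMDiffOn (𝓡 4) (𝓡 4) ∞ (φ ∘ J) U ∧ Set.InjOn (φ ∘ J) U ∧ ∀ x ∈ U, Function.Bijective (mfderiv (𝓡 4) (𝓡 4) (φ ∘ J) x)) := by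
  intro S e X _ _ _ Y _ _ _ J φ hJ
  obtain ⟨U, hU, heU, hs, hi, hd⟩ := hJ
  refine ⟨U, hU, heU, φ.contMDiff.comp_contMDiffOn hs, ?_, ?_⟩
  · -- injectivity
    intro x hx y hy hxy
    exact hi hx hy (EquivLike.injective φ hxy)
  · -- bijective differential
    intro x hx
    have hJx : MDifferentiableAt (𝓡 4) (𝓡 4) J x :=
      ((hs x hx).contMDiffAt (hU.mem_nhds hx)).mdifferentiableAt (by simp)
    have hφx : MDifferentiableAt (𝓡 4) (𝓡 4) φ (J x) :=
      φ.contMDiff.mdifferentiableAt (by simp)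
    rw [mfderiv_comp x hφx hJx]
    exact (bijective_mfderiv_diffeomorph φ (J x)).comp (hd x hx)

end Summit.SmoothPoincare4.SmoothPoincare4.Theorems.OrigamiFoldExistence.StableSeamHost

end
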